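import Mathlib
import Summits.NavierStokesRegularity.NavierStokesRegularity.Theorems.ThreadingFluxHorizonTowerFiniteTowerClassPoly
import Summits.NavierStokesRegularity.NavierStokesRegularity.Theorems.ThreadingFluxHorizonTowerQuadraticGeneratorBrackets
import HarnessLib

/-!
# Crux `PoloidalLiouville` (stmt-NavierStokesRegularity-1222), crux idea «horizon-threading-tower» (ns-idea-15):
# FINITE TOWERS AT ORDER ONE — THE CLASS POLYNOMIAL SPLIT TO LEVEL `N − 4` (top pair, competitor, and the third digit's pairs)

Support file (`--supports stmt-NavierStokesRegularity-1222`, helper; cell `ns-wall-extremal`, width hand ns-wall-eng-3 g6; 0 kit), toward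
THM J «gcd-2 top pair WITH the competitor shell of degree `D′ − 2`, in general degree».

★ `finiteTower_topPair_mod_normSq_cube`: in a finite scale-free tower annihilated by the order-one horizon law off the centre, with top
pair `D′ < D` (`D′ + 2 ≤ D`, `D ≠ D′ + 3`, `D′ ≥ 4`), the class polynomial of level `N = D + D′` (which vanishes,
`finiteTower_classPoly_eq_zero`) reads, with `c = D′ − 2` (the COMPETITOR), `b = D′ − 4`, `λ_j = j(j+1)` and `P̃_l = P_l` if `l ∈ K`, else `0`,
`2(λ_{D′} − λ_D){P_{D′},P_D} + ρ·2(λ_c − λ_D){P̃_c,P_D} + ρ²·(2(λ_b − λ_D){P̃_b,P_D} + e·{P̃_c,P_{D′}}) + ρ³·R = 0`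
with `e = 0` unless `D = D′ + 2` (then `e = 2(λ_c − λ_{D′})`): the pairs on levels `N`, `N − 2`, `N − 4` are exactly `(D′,D)`, `(c,D)`, `(b,D)`
and — only when `D = D′ + 2` — `(c, D′)`; everything else (all shells of either parity below `b`, and all pairs not containing `D`) enters at `ρ³`.
(`…EvenPairSplit`, p713642, is the case «no shell of degree `c`», read to `ρ²`.)  Tool: `sum_sum_ite_pair` (a one-point indicator summed
over `K × K`).

HONEST LABEL: bookkeeping about one crux idea's typed objects; no Prop of the sketch is closed here; `HorizonTowerZonality` (general
towers), `PoloidalLiouville` (1222) OPEN; NS regularity NOT proved.  [folklore]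
-/

-- the summit and its single sub-problem share the name (CONVENTIONS §1)
set_option linter.dupNamespace false
-- `simp only` closers over `C`-coefficients are import-order sensitive (simprocs); keep the lists explicit, silence the arg linter
set_option linter.unusedSimpArgs false

noncomputable section

open MvPolynomial
open scoped RealInnerProductSpace

namespace Summit.NavierStokesRegularity.NavierStokesRegularity.Theorems.PoloidalLiouville.HorizonTower

section FiniteTower

variable (K : Finset ℕ) (H : ℕ → E3 → ℝ)

/-- A one-point indicator summed over `K × K`. [folklore] -/
theorem sum_sum_ite_pair {M : Type*} [AddCommMonoid M] (p q : ℕ) (F : M) [DecidableEq ℕ] :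
    (∑ j ∈ K, ∑ k ∈ K, if j = p ∧ k = q then F else 0) = if p ∈ K ∧ q ∈ K then F else 0 := by
  have hinner : ∀ j ∈ K, (∑ k ∈ K, if j = p ∧ k = q then F else 0) = if j = p then (if q ∈ K then F else 0) else 0 := by
    intro j _
    by_cases hj : j = p
    · simp only [hj, true_and, if_true]
      rw [Finset.sum_ite_eq' K q (fun _ => F)]
    · simp only [hj, false_and, if_false, Finset.sum_const_zero]
  rw [Finset.sum_congr rfl hinner, Finset.sum_ite_eq' K p]
  by_cases hp : p ∈ K
  · by_cases hq : q ∈ K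
    · simp [hp, hq]
    · simp [hp, hq]
  · simp [hp]

/-- ★ **THE CLASS POLYNOMIAL SPLIT TO LEVEL `N − 4`.**  Top pair `D′ < D` with `D′ + 2 ≤ D`, `D ≠ D′ + 3`, `c + 2 = D′`, `b + 4 = D′`;
`P̃_l := P_l` if `l ∈ K` else `0`.  Then for some real `e` (zero unless `D = D′ + 2`) and some polynomial `R`:
`2(λ_{D′}−λ_D){P_{D′},P_D} + ρ·2(λ_c−λ_D){P̃_c,P_D} + ρ²(2(λ_b−λ_D){P̃_b,P_D} + e{P̃_c,P_{D′}}) + ρ³R = 0`. [folklore] -/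
theorem finiteTower_topPair_mod_normSq_cube (hK : ∀ l ∈ K, 1 ≤ l) (hH : ∀ l ∈ K, ContDiff ℝ (⊤ : ℕ∞) (H l))
    (hhom : ∀ l ∈ K, ∀ (c : ℝ) (y : E3), H l (c • y) = c ^ l * H l y)
    (hharm : ∀ l ∈ K, ∀ y, Laplacian.laplacian (H l) y = 0)
    (hL1 : ∀ x : E3, x ≠ 0 → horizonL1 (fun z => ∑ l ∈ K, horizonProfile l (H l) 0 z) 0 x = 0)
    (P : ℕ → MvPolynomial (Fin 3) ℝ) (hP : ∀ l ∈ K, ∀ y, H l y = Zonal.evalE (P l) y)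
    {D D' c b : ℕ} (hD : D ∈ K) (hD' : D' ∈ K) (hDD : D' + 2 ≤ D) (hne3 : D ≠ D' + 3) (hc : c + 2 = D') (hb : b + 4 = D')
    (hmax : ∀ l ∈ K, l ≤ D) (hsec : ∀ l ∈ K, l ≠ D → l ≤ D') :
    ∃ (e : ℝ) (R : MvPolynomial (Fin 3) ℝ), (D ≠ D' + 2 → e = 0) ∧
      C (2 * ((D' : ℝ) * (D' + 1) - (D : ℝ) * (D + 1))) * Zonal.detP (P D') (P D)
        + Zonal.normSq * (C (2 * ((c : ℝ) * (c + 1) - (D : ℝ) * (D + 1))) * Zonal.detP (if c ∈ K then P c else 0) (P D))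
        + Zonal.normSq ^ 2 * (C (2 * ((b : ℝ) * (b + 1) - (D : ℝ) * (D + 1))) * Zonal.detP (if b ∈ K then P b else 0) (P D)
          + C e * Zonal.detP (if c ∈ K then P c else 0) (P D'))
        + Zonal.normSq ^ 3 * R = 0 := by
  classical
  set N : ℕ := D + D' with hN
  set ρ : MvPolynomial (Fin 3) ℝ := X 0 ^ 2 + X 1 ^ 2 + X 2 ^ 2 with hρ
  have hρeq : (Zonal.normSq : MvPolynomial (Fin 3) ℝ) = ρ := rfl
  -- coefficient function and its antisymmetry
  set lam : ℕ → ℕ → ℝ := fun j k => (j : ℝ) * (j + 1) - (k : ℝ) * (k + 1) with hlam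
  have hlam_anti : ∀ j k, lam k j = -lam j k := by intro j k; simp only [hlam]; ring
  -- the class polynomial vanishes
  have hQ := finiteTower_classPoly_eq_zero K H hK hH hhom hharm hL1 P hP N (by
    intro j hj k hk hjk
    have hjD := hmax j hj
    have hkD := hmax k hk
    have : j = D ∧ k = D := by
      constructor
      · by_contra h; have := hsec j hj h; omega
      · by_contra h; have := hsec k hk h; omega
    rw [this.1, this.2, Zonal.detP_self'])
  -- the summand and its decomposition by levels
  set t : ℕ → ℕ → MvPolynomial (Fin 3) ℝ := fun j k =>
    if j + k ≤ N ∧ (j + k) % 2 = N % 2 then C (lam j k) * (ρ ^ ((N - (j + k)) / 2) * Zonal.detP (P j) (P k)) else 0 with ht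
  set pt : ℕ → ℕ → ℕ → ℕ → MvPolynomial (Fin 3) ℝ := fun p q j k =>
    if j = p ∧ k = q then C (lam p q) * Zonal.detP (P p) (P q) else 0 with hpt
  set eN : ℝ := if D = D' + 2 then 1 else 0 with heN
  set r : ℕ → ℕ → MvPolynomial (Fin 3) ℝ := fun j k =>
    if j + k + 6 ≤ N ∧ (j + k) % 2 = N % 2 then C (lam j k) * (ρ ^ ((N - (j + k)) / 2 - 3) * Zonal.detP (P j) (P k)) else 0
    with hr
  have hpt_of : ∀ p q j k, j = p → k = q → pt p q j k = C (lam j k) * Zonal.detP (P j) (P k) := by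
    intro p q j k hj hk; subst hj; subst hk; simp [hpt]
  have hpt_ne : ∀ p q j k, ¬(j = p ∧ k = q) → pt p q j k = 0 := by
    intro p q j k h; simp only [hpt]; rw [if_neg h]
  have hterm : ∀ j ∈ K, ∀ k ∈ K, t j k
      = (pt D' D j k + pt D D' j k)
        + ρ * (pt c D j k + pt D c j k)
        + ρ ^ 2 * ((pt b D j k + pt D b j k) + C eN * (pt c D' j k + pt D' c j k))
        + ρ ^ 3 * r j k := by
    intro j hj k hk
    have hjD := hmax j hj
    have hkD := hmax k hk
    simp only [ht, hr]
    by_cases hcond : j + k ≤ N ∧ (j + k) % 2 = N % 2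
    · rw [if_pos hcond]
      rcases Nat.lt_or_ge (j + k + 5) N with hlow | hhigh
      · -- `j + k + 6 ≤ N`: remainder
        have h6 : j + k + 6 ≤ N := by omega
        rw [if_pos ⟨h6, hcond.2⟩]
        have h1 : ¬(j = D' ∧ k = D) := by rintro ⟨rfl, rfl⟩; omega
        have h2 : ¬(j = D ∧ k = D') := by rintro ⟨rfl, rfl⟩; omega
        have h3 : ¬(j = c ∧ k = D) := by rintro ⟨rfl, rfl⟩; omega
        have h4 : ¬(j = D ∧ k = c) := by rintro ⟨rfl, rfl⟩; omega
        have h5 : ¬(j = b ∧ k = D) := by rintro ⟨rfl, rfl⟩; omega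
        have h6' : ¬(j = D ∧ k = b) := by rintro ⟨rfl, rfl⟩; omega
        rw [hpt_ne _ _ _ _ h1, hpt_ne _ _ _ _ h2, hpt_ne _ _ _ _ h3, hpt_ne _ _ _ _ h4, hpt_ne _ _ _ _ h5, hpt_ne _ _ _ _ h6']
        obtain ⟨q, hq⟩ : ∃ q, (N - (j + k)) / 2 = q + 3 := ⟨(N - (j + k)) / 2 - 3, by omega⟩
        rw [hq, Nat.add_sub_cancel, pow_add]
        -- the pair `(c, D′)` lies on level `≤ N − 6` exactly when `D ≠ D′ + 2`, and then `eN = 0`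
        by_cases hD2 : D = D' + 2
        · have h7 : ¬(j = c ∧ k = D') := by rintro ⟨rfl, rfl⟩; omega
          have h8 : ¬(j = D' ∧ k = c) := by rintro ⟨rfl, rfl⟩; omega
          rw [hpt_ne _ _ _ _ h7, hpt_ne _ _ _ _ h8]
          simp only [mul_zero, add_zero, zero_add]
          ring
        · have heN0 : eN = 0 := by simp [heN, hD2]
          rw [heN0, map_zero]
          ring
      · -- by parity `j + k ∈ {N, N − 2, N − 4}`
        have hr0 : ¬(j + k + 6 ≤ N ∧ (j + k) % 2 = N % 2) := fun h => by omega
        rw [if_neg hr0, mul_zero, add_zero]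
        have hcases : j + k = N ∨ j + k + 2 = N ∨ j + k + 4 = N := by omega
        rcases hcases with hs | hs | hs
        · -- level `N`: the top pair
          have h3 : ¬(j = c ∧ k = D) := by rintro ⟨rfl, rfl⟩; omega
          have h4 : ¬(j = D ∧ k = c) := by rintro ⟨rfl, rfl⟩; omega
          have h5 : ¬(j = b ∧ k = D) := by rintro ⟨rfl, rfl⟩; omega
          have h6' : ¬(j = D ∧ k = b) := by rintro ⟨rfl, rfl⟩; omega
          have h7 : ¬(j = c ∧ k = D') := by rintro ⟨rfl, rfl⟩; omega
          have h8 : ¬(j = D' ∧ k = c) := by rintro ⟨rfl, rfl⟩; omega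
          rw [hpt_ne _ _ _ _ h3, hpt_ne _ _ _ _ h4, hpt_ne _ _ _ _ h5, hpt_ne _ _ _ _ h6', hpt_ne _ _ _ _ h7, hpt_ne _ _ _ _ h8,
            show (N - (j + k)) / 2 = 0 by omega, pow_zero, one_mul]
          rcases eq_or_ne k D with rfl | hkne
          · have hj' : j = D' := by omega
            have h2 : ¬(j = k ∧ k = D') := by rintro ⟨rfl, -⟩; omega
            rw [hpt_of D' k j k hj' rfl, hpt_ne _ _ _ _ h2]
            simp only [mul_zero, add_zero]
          · have hk' := hsec k hk hkne
            have hjD2 : j = D := by omega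
            have hkD2 : k = D' := by omega
            have h1 : ¬(j = D' ∧ k = D) := by rintro ⟨-, rfl⟩; exact hkne rfl
            rw [hpt_ne _ _ _ _ h1, hpt_of D D' j k hjD2 hkD2]
            simp only [mul_zero, add_zero, zero_add]
        · -- level `N − 2`: the competitor against the top
          have h1 : ¬(j = D' ∧ k = D) := by rintro ⟨rfl, rfl⟩; omega
          have h2 : ¬(j = D ∧ k = D') := by rintro ⟨rfl, rfl⟩; omega
          have h5 : ¬(j = b ∧ k = D) := by rintro ⟨rfl, rfl⟩; omega
          have h6' : ¬(j = D ∧ k = b) := by rintro ⟨rfl, rfl⟩; omega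
          have h7 : ¬(j = c ∧ k = D') := by rintro ⟨rfl, rfl⟩; omega
          have h8 : ¬(j = D' ∧ k = c) := by rintro ⟨rfl, rfl⟩; omega
          rw [hpt_ne _ _ _ _ h1, hpt_ne _ _ _ _ h2, hpt_ne _ _ _ _ h5, hpt_ne _ _ _ _ h6', hpt_ne _ _ _ _ h7, hpt_ne _ _ _ _ h8,
            show (N - (j + k)) / 2 = 1 by omega, pow_one]
          rcases eq_or_ne k D with rfl | hkne
          · have hj' : j = c := by omega
            have h4 : ¬(j = k ∧ k = c) := by rintro ⟨rfl, -⟩; omega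
            rw [hpt_of c k j k hj' rfl, hpt_ne _ _ _ _ h4]
            simp only [mul_zero, add_zero, zero_add]
            ring
          · rcases eq_or_ne j D with rfl | hjne
            · have hk' : k = c := by omega
              have h3 : ¬(j = c ∧ k = j) := by rintro ⟨-, rfl⟩; exact hkne rfl
              rw [hpt_ne _ _ _ _ h3, hpt_of j c j k rfl hk']
              simp only [mul_zero, add_zero, zero_add]
              ring
            · -- both `≤ D′`: then `j = k = D′` (and `D = D′ + 2`), coefficient zero
              have hj' := hsec j hj hjne
              have hk' := hsec k hk hkne
              have hjk : j = D' ∧ k = D' := by omega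
              have h3 : ¬(j = c ∧ k = D) := by rintro ⟨-, rfl⟩; exact hkne rfl
              have h4 : ¬(j = D ∧ k = c) := by rintro ⟨rfl, -⟩; exact hjne rfl
              rw [hpt_ne _ _ _ _ h3, hpt_ne _ _ _ _ h4, hjk.1, hjk.2]
              simp only [hlam, sub_self, map_zero, zero_mul, mul_zero, add_zero]
        · -- level `N − 4`: the third digit's pairs
          have h1 : ¬(j = D' ∧ k = D) := by rintro ⟨rfl, rfl⟩; omega
          have h2 : ¬(j = D ∧ k = D') := by rintro ⟨rfl, rfl⟩; omega
          have h3 : ¬(j = c ∧ k = D) := by rintro ⟨rfl, rfl⟩; omega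
          have h4 : ¬(j = D ∧ k = c) := by rintro ⟨rfl, rfl⟩; omega
          rw [hpt_ne _ _ _ _ h1, hpt_ne _ _ _ _ h2, hpt_ne _ _ _ _ h3, hpt_ne _ _ _ _ h4,
            show (N - (j + k)) / 2 = 2 by omega]
          rcases eq_or_ne k D with rfl | hkne
          · have hj' : j = b := by omega
            have h6' : ¬(j = k ∧ k = b) := by rintro ⟨rfl, -⟩; omega
            have h7 : ¬(j = c ∧ k = D') := by rintro ⟨-, rfl⟩; omega
            have h8 : ¬(j = D' ∧ k = c) := by rintro ⟨-, rfl⟩; omega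
            rw [hpt_of b k j k hj' rfl, hpt_ne _ _ _ _ h6', hpt_ne _ _ _ _ h7, hpt_ne _ _ _ _ h8]
            simp only [mul_zero, add_zero, zero_add]
            ring
          · rcases eq_or_ne j D with rfl | hjne
            · have hk' : k = b := by omega
              have h5 : ¬(j = b ∧ k = j) := by rintro ⟨-, rfl⟩; exact hkne rfl
              have h7 : ¬(j = c ∧ k = D') := by rintro ⟨rfl, -⟩; omega
              have h8 : ¬(j = D' ∧ k = c) := by rintro ⟨rfl, -⟩; omega
              rw [hpt_ne _ _ _ _ h5, hpt_of j b j k rfl hk', hpt_ne _ _ _ _ h7, hpt_ne _ _ _ _ h8]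
              simp only [mul_zero, add_zero, zero_add]
              ring
            · -- both `≤ D′`: `D = D′ + 2` and `{j,k} = {c, D′}`, or a diagonal pair (coefficient zero), or `D = D′ + 4`, `j = k = D′`
              have hj' := hsec j hj hjne
              have hk' := hsec k hk hkne
              have h5 : ¬(j = b ∧ k = D) := by rintro ⟨-, rfl⟩; exact hkne rfl
              have h6' : ¬(j = D ∧ k = b) := by rintro ⟨rfl, -⟩; exact hjne rfl
              rw [hpt_ne _ _ _ _ h5, hpt_ne _ _ _ _ h6']
              by_cases hjk : j = k
              · subst hjk
                have h7 : ¬(j = c ∧ j = D') := by rintro ⟨rfl, h⟩; omega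
                have h8 : ¬(j = D' ∧ j = c) := by rintro ⟨rfl, h⟩; omega
                rw [hpt_ne _ _ _ _ h7, hpt_ne _ _ _ _ h8]
                simp only [hlam, sub_self, map_zero, zero_mul, mul_zero, add_zero]
              · have hD2 : D = D' + 2 := by omega
                have heN1 : eN = 1 := by simp [heN, hD2]
                rcases eq_or_ne k D' with rfl | hkne'
                · have hjc : j = c := by omega
                  have h8 : ¬(j = k ∧ k = c) := by rintro ⟨rfl, -⟩; exact hjk rfl
                  rw [hpt_of c k j k hjc rfl, hpt_ne _ _ _ _ h8, heN1]
                  simp only [map_one, mul_zero, add_zero, zero_add, one_mul]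
                  ring
                · have hjD' : j = D' := by omega
                  have hkc : k = c := by omega
                  have h7 : ¬(j = c ∧ k = D') := by rintro ⟨-, rfl⟩; exact hkne' rfl
                  rw [hpt_ne _ _ _ _ h7, hpt_of D' c j k hjD' hkc, heN1]
                  simp only [map_one, mul_zero, add_zero, zero_add, one_mul]
                  ring
    · rw [if_neg hcond]
      have hr0 : ¬(j + k + 6 ≤ N ∧ (j + k) % 2 = N % 2) := fun h => hcond ⟨by omega, h.2⟩
      have hpar : ∀ p q, p + q ≤ N → (p + q) % 2 = N % 2 → ¬(j = p ∧ k = q) := by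
        rintro p q h1 h2 ⟨rfl, rfl⟩; exact hcond ⟨h1, h2⟩
      have h1 := hpar D' D (by omega) (by rw [hN, add_comm])
      have h2 := hpar D D' (by omega) (by rw [hN])
      have h3 := hpar c D (by omega) (by rw [hN]; omega)
      have h4 := hpar D c (by omega) (by rw [hN]; omega)
      have h5 := hpar b D (by omega) (by rw [hN]; omega)
      have h6' := hpar D b (by omega) (by rw [hN]; omega)
      rw [if_neg hr0, hpt_ne _ _ _ _ h1, hpt_ne _ _ _ _ h2, hpt_ne _ _ _ _ h3, hpt_ne _ _ _ _ h4, hpt_ne _ _ _ _ h5,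
        hpt_ne _ _ _ _ h6']
      by_cases hD2 : D = D' + 2
      · have h7 := hpar c D' (by omega) (by rw [hN]; omega)
        have h8 := hpar D' c (by omega) (by rw [hN]; omega)
        rw [hpt_ne _ _ _ _ h7, hpt_ne _ _ _ _ h8]
        simp only [mul_zero, add_zero]
      · have heN0 : eN = 0 := by simp [heN, hD2]
        rw [heN0, map_zero]
        ring
  -- sum of each piece
  have hsum_pt : ∀ p q, p ≠ q → (∑ j ∈ K, ∑ k ∈ K, (pt p q j k + pt q p j k))
      = if p ∈ K ∧ q ∈ K then C (2 * lam p q) * Zonal.detP (P p) (P q) else 0 := by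
    intro p q hpq
    simp only [Finset.sum_add_distrib, hpt]
    rw [sum_sum_ite_pair K p q, sum_sum_ite_pair K q p]
    by_cases h : p ∈ K ∧ q ∈ K
    · rw [if_pos h, if_pos ⟨h.2, h.1⟩, if_pos h, hlam_anti p q, Zonal.detP_antisymm (P p) (P q)]
      simp only [map_neg, map_mul, map_ofNat]
      ring
    · have h' : ¬(q ∈ K ∧ p ∈ K) := fun h2 => h ⟨h2.2, h2.1⟩
      rw [if_neg h, if_neg h', if_neg h, add_zero]
  have hsplit : (∑ j ∈ K, ∑ k ∈ K, t j k)
      = (∑ j ∈ K, ∑ k ∈ K, (pt D' D j k + pt D D' j k))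
        + ρ * (∑ j ∈ K, ∑ k ∈ K, (pt c D j k + pt D c j k))
        + ρ ^ 2 * ((∑ j ∈ K, ∑ k ∈ K, (pt b D j k + pt D b j k)) + C eN * (∑ j ∈ K, ∑ k ∈ K, (pt c D' j k + pt D' c j k)))
        + ρ ^ 3 * ∑ j ∈ K, ∑ k ∈ K, r j k := by
    rw [Finset.sum_congr rfl (fun j hj => Finset.sum_congr rfl (fun k hk => hterm j hj k hk))]
    simp only [Finset.sum_add_distrib, Finset.mul_sum, mul_add]
  have h0 : (∑ j ∈ K, ∑ k ∈ K, t j k) = 0 := hQ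
  rw [hsplit, hsum_pt D' D (by omega), hsum_pt c D (by omega), hsum_pt b D (by omega), hsum_pt c D' (by omega),
    if_pos ⟨hD', hD⟩] at h0
  refine ⟨if D = D' + 2 then (if c ∈ K then 2 * lam c D' else 0) else 0, ∑ j ∈ K, ∑ k ∈ K, r j k, ?_, ?_⟩
  · intro hne; rw [if_neg hne]
  rw [hρeq]
  -- identify the indicator sums with the `P̃` brackets
  have hdet0 : ∀ Q : MvPolynomial (Fin 3) ℝ, Zonal.detP 0 Q = 0 := fun Q => by
    rw [← C_0, Zonal.detP_C_left, C_0]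
  have hcD : (if c ∈ K ∧ D ∈ K then C (2 * lam c D) * Zonal.detP (P c) (P D) else 0)
      = C (2 * lam c D) * Zonal.detP (if c ∈ K then P c else 0) (P D) := by
    by_cases h : c ∈ K
    · rw [if_pos ⟨h, hD⟩, if_pos h]
    · rw [if_neg (fun h2 => h h2.1), if_neg h, hdet0, mul_zero]
  have hbD : (if b ∈ K ∧ D ∈ K then C (2 * lam b D) * Zonal.detP (P b) (P D) else 0)
      = C (2 * lam b D) * Zonal.detP (if b ∈ K then P b else 0) (P D) := by
    by_cases h : b ∈ K
    · rw [if_pos ⟨h, hD⟩, if_pos h]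
    · rw [if_neg (fun h2 => h h2.1), if_neg h, hdet0, mul_zero]
  have hcD' : C eN * (if c ∈ K ∧ D' ∈ K then C (2 * lam c D') * Zonal.detP (P c) (P D') else 0)
      = C (if D = D' + 2 then (if c ∈ K then 2 * lam c D' else 0) else 0) * Zonal.detP (if c ∈ K then P c else 0) (P D') := by
    by_cases h2 : D = D' + 2
    · have heN1 : eN = 1 := by simp [heN, h2]
      rw [heN1, if_pos h2, map_one, one_mul]
      by_cases h : c ∈ K
      · rw [if_pos ⟨h, hD'⟩, if_pos h, if_pos h]
      · rw [if_neg (fun h3 => h h3.1), if_neg h, if_neg h, hdet0, mul_zero]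
    · have heN0 : eN = 0 := by simp [heN, h2]
      rw [heN0, if_neg h2, map_zero, zero_mul, zero_mul]
  rw [hcD, hbD, hcD'] at h0
  simp only [hlam] at h0
  exact h0

end FiniteTower

end Summit.NavierStokesRegularity.NavierStokesRegularity.Theorems.PoloidalLiouville.HorizonTower

end
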